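import Literature.AlgebraicGeometry.Resolution.ProperModels
import Literature.AlgebraicGeometry.Resolution.ProjectiveModelsDomination
import HarnessLib

/-!
# The closure of a `K`-point in a proper `k`-scheme and the join of two proper models

Topic: `Literature/AlgebraicGeometry/Resolution`. The PROPER-model twin of the closure-model and
join constructions of `ProjectiveModelsDomination.lean` (Zariski–Samuel II, Ch. VI §17: the join
of two models = closure of the graph of the birational correspondence; Piltant 2013, proof of
Prop. 5.1, Step 2 and Lemma 3.3), for the proper models `ProperModel k K` of `ProperModels.lean`.
Everything is PROVED, verbatim from the projective case with "projective over `k`" replaced by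
"proper over `k`" (a closed subscheme of a proper `k`-scheme is proper; `M₁ ×ₖ M₂` is proper).

* `ProperModel.ofClosure` — the scheme-theoretic image of a `K`-point `Spec K → Q` of a PROPER
  `k`-scheme `Q` lying over the generic point of a proper model is a proper model;
  `ofClosure.homOf`, `ofClosure.isIso_homOf_morphismRestrict` (isomorphy over the domain of
  definition, Piltant 2013, Lemma 3.3).
* `ProperModel.join M₁ M₂`, `joinFst`, `joinSnd` — the join of two proper models and its two
  dominations; `isIso_joinFst_morphismRestrict`, `isIso_joinSnd_morphismRestrict`.

## References

* O. Zariski, P. Samuel, *Commutative Algebra* II, Ch. VI §17. [ZariskiSamuel1960]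
* O. Piltant, RACSAM 107 (2013), Lemma 3.3 and Prop. 5.1 (proof, Step 2). [Piltant2013]
-/

noncomputable section

open CategoryTheory AlgebraicGeometry TopologicalSpace IsLocalRing MonoidalCategory

namespace Literature.AlgebraicGeometry.Resolution

namespace ProperModel

universe u

variable {k K : Type u} [Field k] [Field K] [Algebra k K]

/-- A morphism into a proper model through which the `K`-point factors is dominant. [folklore] -/
theorem isDominant_of_comp_eq_gen {N : ProperModel k K} {Z : Scheme.{u}} (h : Z ⟶ N.X)
    (s : Spec (CommRingCat.of K) ⟶ Z) (hs : s ≫ h = N.gen) : IsDominant h := by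
  have : IsDominant (s ≫ h) := by rw [hs]; infer_instance
  exact IsDominant.of_comp s h

/-- A dominant section over an open forces an isomorphism there (`ChowLemmaProof`). [folklore] -/
theorem Hom.isIso_morphismRestrict_of_section {N M : ProperModel k K} (φ : N.Hom M)
    (U : M.X.Opens) (h : (U : Scheme.{u}) ⟶ N.X) [IsDominant h] (w : h ≫ φ.f = U.ι) :
    IsIso (φ.f ∣_ U) :=
  (ChowLemmaProof.isIso_morphismRestrict_of_section φ.f U h w).1

/-! ## The closure of a `K`-point in a proper `k`-scheme is a proper model -/

section Closure

variable (M : ProperModel k K) {Q : Motives.SchemeOver k} [IsProper Q.hom]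
  (rl : Spec (CommRingCat.of K) ⟶ Q.left) (s : Q.left ⟶ M.X) (hs : s ≫ M.π = Q.hom)
  (hr : rl ≫ s = M.gen)

include hr in
omit [IsProper Q.hom] in
/-- `𝒪_{Z,ξ} → K` is an isomorphism for the closure `Z` of a `K`-point `rl` with `rl ≫ s = gen_M`.
[folklore] -/
theorem isIso_stalkClosedPointTo_toImage : IsIso (Scheme.stalkClosedPointTo rl.toImage) := by
  let g := rl.toImage
  let c := rl.imageι
  have hgc : g ≫ c = rl := Scheme.Hom.toImage_imageι rl
  have e : g ≫ (c ≫ s) = M.gen := by rw [reassoc_of% hgc, hr]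
  have h1 : IsIso (Scheme.stalkClosedPointTo (g ≫ (c ≫ s))) := by
    rw [e]
    infer_instance
  rw [Scheme.stalkClosedPointTo_comp] at h1
  have hsurj : Function.Surjective (Scheme.stalkClosedPointTo g).hom := by
    obtain ⟨w, -, hw⟩ := h1.out
    intro y
    have h2 := congrArg (fun φ => φ.hom y) hw
    exact ⟨_, h2⟩
  have hF : IsField (rl.image.presheaf.stalk (g (closedPoint K))) := by
    rw [show g (closedPoint K) = genericPoint rl.image from ProjModel.toImage_closedPoint rl]
    exact Field.toIsField _
  letI := hF.toField
  exact (ConcreteCategory.isIso_iff_bijective _).mpr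
    ⟨(Scheme.stalkClosedPointTo g).hom.injective, hsurj⟩

include hs hr in
omit [IsProper Q.hom] in
/-- The `K`-point `rl` lies over `Spec K → Spec k`. [folklore] -/
theorem point_comp_hom : rl ≫ Q.hom = Spec.map (CommRingCat.ofHom (algebraMap k K)) := by
  rw [← hs, reassoc_of% hr, M.gen_π]

/-- **The closure model** of a `K`-point `rl : Spec K → Q` of a PROPER `k`-scheme `Q` lying over
the generic point of a proper model `M` (through a `k`-morphism `s : Q → M` with `rl ≫ s = gen_M`):
the scheme-theoretic image of `rl` — an integral closed subscheme of `Q`, proper over `k`, with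
function field `K` (closures of graphs of rational maps, Piltant 2013, Lemma 3.3).
[cite: ZariskiSamuel1960, Ch. VI §17] -/
def ofClosure : ProperModel k K where
  X := rl.image
  π := rl.imageι ≫ Q.hom
  gen := rl.toImage
  gen_π := by rw [Scheme.Hom.toImage_imageι_assoc, point_comp_hom M rl s hs hr]
  isIntegral := inferInstance
  isProper := inferInstance
  genericPt_eq := ProjModel.toImage_closedPoint rl
  isIso_stalkClosedPointTo := isIso_stalkClosedPointTo_toImage M rl s hr

/-- The underlying scheme of the closure model is the scheme-theoretic image. [folklore] -/
@[simp]
theorem ofClosure_X : (ofClosure M rl s hs hr).X = rl.image := rfl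

/-- The `K`-point of the closure model is `rl.toImage`. [folklore] -/
@[simp]
theorem ofClosure_gen : (ofClosure M rl s hs hr).gen = rl.toImage := rfl

/-- The structure morphism of the closure model. [folklore] -/
@[simp]
theorem ofClosure_π : (ofClosure M rl s hs hr).π = rl.imageι ≫ Q.hom := rfl

/-- **The closure model dominates every model under `Q` compatibly with the `K`-point.**
[cite: ZariskiSamuel1960, Ch. VI §17] -/
def ofClosure.homOf (M' : ProperModel k K) (s' : Q.left ⟶ M'.X) (hs' : s' ≫ M'.π = Q.hom)
    (hr' : rl ≫ s' = M'.gen) : (ofClosure M rl s hs hr).Hom M' where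
  f := rl.imageι ≫ s'
  f_π := by
    show (rl.imageι ≫ s') ≫ M'.π = rl.imageι ≫ Q.hom
    rw [Category.assoc, hs']
  gen_f := by
    show rl.toImage ≫ rl.imageι ≫ s' = M'.gen
    rw [Scheme.Hom.toImage_imageι_assoc, hr']

/-- The underlying morphism of `ofClosure.homOf`. [folklore] -/
@[simp]
theorem ofClosure.homOf_f (M' : ProperModel k K) (s' : Q.left ⟶ M'.X) (hs' : s' ≫ M'.π = Q.hom)
    (hr' : rl ≫ s' = M'.gen) :
    (ofClosure.homOf M rl s hs hr M' s' hs' hr').f = rl.imageι ≫ s' := rfl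

/-- The generic point of a non-empty open subscheme `U` of a proper model `M'`: a `K`-point of
`U` lying over `gen_{M'}` hits the generic point of `U`. [folklore] -/
theorem eq_genericPoint_of_comp_ι {M' : ProperModel k K} (U : M'.X.Opens)
    (sU : Spec (CommRingCat.of K) ⟶ (U : Scheme.{u})) (hsU : sU ≫ U.ι = M'.gen) :
    haveI : Nonempty (U : Scheme.{u}) := ⟨sU (closedPoint K)⟩
    haveI : IsIntegral (U : Scheme.{u}) := isIntegral_of_isOpenImmersion U.ι
    sU (closedPoint K) = genericPoint (U : Scheme.{u}) := by
  haveI : Nonempty (U : Scheme.{u}) := ⟨sU (closedPoint K)⟩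
  haveI : IsIntegral (U : Scheme.{u}) := isIntegral_of_isOpenImmersion U.ι
  apply U.ι.isOpenEmbedding.injective
  rw [genericPoint_eq_of_isOpenImmersion U.ι, ← Scheme.Hom.comp_apply, hsU]
  exact M'.genericPt_eq

/-- **The closure model is isomorphic to `M'` over the domain of definition** (Piltant 2013,
Lemma 3.3): if over the open `U ⊆ M'` there is a section `f : U → Q` of `s' : Q → M'` through
which the `K`-point factors, then `Z → M'` is an isomorphism over `U`.
[cite: Piltant2013, Lemma 3.3] -/
theorem ofClosure.isIso_homOf_morphismRestrict (M' : ProperModel k K) (s' : Q.left ⟶ M'.X)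
    (hs' : s' ≫ M'.π = Q.hom) (hr' : rl ≫ s' = M'.gen) (U : M'.X.Opens)
    (f : (U : Scheme.{u}) ⟶ Q.left) (hf : f ≫ s' = U.ι) (sU : Spec (CommRingCat.of K) ⟶ U)
    (hsU : sU ≫ f = rl) :
    IsIso ((ofClosure.homOf M rl s hs hr M' s' hs' hr').f ∣_ U) := by
  have hsUι : sU ≫ U.ι = M'.gen := by rw [← hf, reassoc_of% hsU, hr']
  haveI : Nonempty (U : Scheme.{u}) := ⟨sU (closedPoint K)⟩
  haveI : IsIntegral (U : Scheme.{u}) := isIntegral_of_isOpenImmersion U.ι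
  have hη : sU (closedPoint K) = genericPoint (U : Scheme.{u}) :=
    eq_genericPoint_of_comp_ι U sU hsUι
  -- `f(U) ⊆ closure {rl} = Z`
  have hrange : Set.range f ⊆ Set.range rl.imageι := by
    rw [Scheme.IdealSheafData.range_subschemeι, Scheme.Hom.support_ker]
    rintro _ ⟨u, rfl⟩
    have hu : u ∈ closure ({genericPoint (U : Scheme.{u})} : Set (U : Scheme.{u})) := by
      rw [genericPoint_closure]
      trivial
    have h1 : f u ∈ closure (f '' {genericPoint (U : Scheme.{u})}) :=
      map_mem_closure f.continuous hu fun x hx => Set.mem_image_of_mem f hx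
    rw [Set.image_singleton, ← hη, ← Scheme.Hom.comp_apply, hsU] at h1
    have hmem : rl (closedPoint K) ∈ Set.range rl := ⟨_, rfl⟩
    exact closure_mono (Set.singleton_subset_iff.mpr hmem) h1
  -- the section `U → Z`
  let h : (U : Scheme.{u}) ⟶ rl.image := IsClosedImmersion.liftOfRange rl.imageι f hrange
  have hw : h ≫ (rl.imageι ≫ s') = U.ι := by
    rw [← Category.assoc, IsClosedImmersion.liftOfRange_fac, hf]
  have hsh : sU ≫ h = rl.toImage := by
    rw [← cancel_mono rl.imageι, Category.assoc, IsClosedImmersion.liftOfRange_fac, hsU,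
      Scheme.Hom.toImage_imageι]
  haveI : @IsDominant _ (ofClosure M rl s hs hr).X h :=
    isDominant_of_comp_eq_gen (N := ofClosure M rl s hs hr) h sU hsh
  exact Hom.isIso_morphismRestrict_of_section (ofClosure.homOf M rl s hs hr M' s' hs' hr')
    U h hw

end Closure

/-! ## The join of two proper models -/

section Join

/-- A proper model as a `k`-scheme (an object of `Over (Spec k)`). [folklore] -/
def toOver (M : ProperModel k K) : Motives.SchemeOver k :=
  Over.mk M.π

/-- The underlying scheme of `M.toOver`. [folklore] -/
@[simp] theorem toOver_left (M : ProperModel k K) : M.toOver.left = M.X := rfl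

/-- The structure morphism of `M.toOver`. [folklore] -/
@[simp] theorem toOver_hom (M : ProperModel k K) : M.toOver.hom = M.π := rfl

/-- The `K`-point of a model as a morphism of `k`-schemes `Spec K → M`. [folklore] -/
def genOver (M : ProperModel k K) : ProjModel.specOverK k K ⟶ M.toOver :=
  Over.homMk M.gen M.gen_π

/-- The underlying morphism of `genOver`. [folklore] -/
@[simp] theorem genOver_left (M : ProperModel k K) : (genOver M).left = M.gen := rfl

variable (M₁ M₂ : ProperModel k K)

/-- The ambient product `M₁ ×ₖ M₂` of two proper models, a proper `k`-scheme. [folklore] -/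
abbrev joinAmbient : Motives.SchemeOver k :=
  M₁.toOver ⊗ M₂.toOver

/-- `M₁ ×ₖ M₂ → Spec k` is proper. [folklore] -/
instance isProper_joinAmbient_hom : IsProper (joinAmbient M₁ M₂).hom := by
  change IsProper (Limits.pullback.fst M₁.π M₂.π ≫ M₁.π)
  infer_instance

/-- The diagonal `K`-point `Spec K → M₁ ×ₖ M₂` as a morphism of `k`-schemes. [folklore] -/
def joinPointOver : ProjModel.specOverK k K ⟶ joinAmbient M₁ M₂ :=
  CartesianMonoidalCategory.lift (genOver M₁) (genOver M₂)

/-- The diagonal `K`-point `Spec K → M₁ ×ₖ M₂`, `(gen₁, gen₂)`. [folklore] -/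
def joinPoint : Spec (CommRingCat.of K) ⟶ (joinAmbient M₁ M₂).left :=
  (joinPointOver M₁ M₂).left

/-- The first projection `M₁ ×ₖ M₂ → M₁`. [folklore] -/
def joinAmbientFst : (joinAmbient M₁ M₂).left ⟶ M₁.X :=
  (CartesianMonoidalCategory.fst M₁.toOver M₂.toOver).left

/-- The second projection `M₁ ×ₖ M₂ → M₂`. [folklore] -/
def joinAmbientSnd : (joinAmbient M₁ M₂).left ⟶ M₂.X :=
  (CartesianMonoidalCategory.snd M₁.toOver M₂.toOver).left

/-- The first projection is a `k`-morphism. [folklore] -/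
@[reassoc]
theorem joinAmbientFst_π : joinAmbientFst M₁ M₂ ≫ M₁.π = (joinAmbient M₁ M₂).hom :=
  Over.w (CartesianMonoidalCategory.fst M₁.toOver M₂.toOver)

/-- The second projection is a `k`-morphism. [folklore] -/
@[reassoc]
theorem joinAmbientSnd_π : joinAmbientSnd M₁ M₂ ≫ M₂.π = (joinAmbient M₁ M₂).hom :=
  Over.w (CartesianMonoidalCategory.snd M₁.toOver M₂.toOver)

/-- The first component of the diagonal point is `gen₁`. [folklore] -/
@[reassoc]
theorem joinPoint_fst : joinPoint M₁ M₂ ≫ joinAmbientFst M₁ M₂ = M₁.gen := by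
  show (joinPointOver M₁ M₂).left ≫ (CartesianMonoidalCategory.fst M₁.toOver M₂.toOver).left =
    (genOver M₁).left
  rw [← Over.comp_left, joinPointOver, CartesianMonoidalCategory.lift_fst]

/-- The second component of the diagonal point is `gen₂`. [folklore] -/
@[reassoc]
theorem joinPoint_snd : joinPoint M₁ M₂ ≫ joinAmbientSnd M₁ M₂ = M₂.gen := by
  show (joinPointOver M₁ M₂).left ≫ (CartesianMonoidalCategory.snd M₁.toOver M₂.toOver).left =
    (genOver M₂).left
  rw [← Over.comp_left, joinPointOver, CartesianMonoidalCategory.lift_snd]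

/-- **The join** `J(M₁, M₂)` of two proper models of `K/k`: the closure model of the diagonal
`K`-point in `M₁ ×ₖ M₂` (closure of the graph of the birational correspondence).
[cite: ZariskiSamuel1960, Ch. VI §17] -/
def join : ProperModel k K :=
  ofClosure M₁ (joinPoint M₁ M₂) (joinAmbientFst M₁ M₂) (joinAmbientFst_π M₁ M₂)
    (joinPoint_fst M₁ M₂)

/-- The join dominates the first model. [cite: ZariskiSamuel1960, Ch. VI §17] -/
def joinFst : (join M₁ M₂).Hom M₁ :=
  ofClosure.homOf M₁ _ _ _ _ M₁ (joinAmbientFst M₁ M₂) (joinAmbientFst_π M₁ M₂)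
    (joinPoint_fst M₁ M₂)

/-- The join dominates the second model. [cite: ZariskiSamuel1960, Ch. VI §17] -/
def joinSnd : (join M₁ M₂).Hom M₂ :=
  ofClosure.homOf M₁ _ _ _ _ M₂ (joinAmbientSnd M₁ M₂) (joinAmbientSnd_π M₁ M₂)
    (joinPoint_snd M₁ M₂)

variable {M₁ M₂}

/-- A `k`-morphism `V → M₁ ×ₖ M₂` from a `k`-scheme with given components. [folklore] -/
def liftToJoinAmbient {V : Scheme.{u}} (v : V ⟶ Spec (CommRingCat.of k)) (g₁ : V ⟶ M₁.X)
    (g₂ : V ⟶ M₂.X) (hg₁ : g₁ ≫ M₁.π = v) (hg₂ : g₂ ≫ M₂.π = v) :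
    Over.mk v ⟶ joinAmbient M₁ M₂ :=
  CartesianMonoidalCategory.lift (Over.homMk g₁ hg₁ : Over.mk v ⟶ M₁.toOver)
    (Over.homMk g₂ hg₂ : Over.mk v ⟶ M₂.toOver)

/-- The first component of `liftToJoinAmbient`. [folklore] -/
@[reassoc]
theorem liftToJoinAmbient_fst {V : Scheme.{u}} (v : V ⟶ Spec (CommRingCat.of k))
    (g₁ : V ⟶ M₁.X) (g₂ : V ⟶ M₂.X) (hg₁ : g₁ ≫ M₁.π = v) (hg₂ : g₂ ≫ M₂.π = v) :
    (liftToJoinAmbient v g₁ g₂ hg₁ hg₂).left ≫ joinAmbientFst M₁ M₂ = g₁ := by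
  show (liftToJoinAmbient v g₁ g₂ hg₁ hg₂).left ≫
      (CartesianMonoidalCategory.fst M₁.toOver M₂.toOver).left =
    (Over.homMk g₁ hg₁ : Over.mk v ⟶ M₁.toOver).left
  rw [← Over.comp_left, liftToJoinAmbient, CartesianMonoidalCategory.lift_fst]

/-- The second component of `liftToJoinAmbient`. [folklore] -/
@[reassoc]
theorem liftToJoinAmbient_snd {V : Scheme.{u}} (v : V ⟶ Spec (CommRingCat.of k))
    (g₁ : V ⟶ M₁.X) (g₂ : V ⟶ M₂.X) (hg₁ : g₁ ≫ M₁.π = v) (hg₂ : g₂ ≫ M₂.π = v) :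
    (liftToJoinAmbient v g₁ g₂ hg₁ hg₂).left ≫ joinAmbientSnd M₁ M₂ = g₂ := by
  show (liftToJoinAmbient v g₁ g₂ hg₁ hg₂).left ≫
      (CartesianMonoidalCategory.snd M₁.toOver M₂.toOver).left =
    (Over.homMk g₂ hg₂ : Over.mk v ⟶ M₂.toOver).left
  rw [← Over.comp_left, liftToJoinAmbient, CartesianMonoidalCategory.lift_snd]

/-- **A `K`-point of `M₁ ×ₖ M₂` with components `gen₁`, `gen₂` is the diagonal point.**
[folklore] -/
theorem comp_left_eq_joinPoint {V : Scheme.{u}} (v : V ⟶ Spec (CommRingCat.of k))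
    (g₁ : V ⟶ M₁.X) (g₂ : V ⟶ M₂.X) (hg₁ : g₁ ≫ M₁.π = v) (hg₂ : g₂ ≫ M₂.π = v)
    (sV : Spec (CommRingCat.of K) ⟶ V) (h₁ : sV ≫ g₁ = M₁.gen) (h₂ : sV ≫ g₂ = M₂.gen) :
    sV ≫ (liftToJoinAmbient v g₁ g₂ hg₁ hg₂).left = joinPoint M₁ M₂ := by
  have hsO : sV ≫ (Over.mk v).hom = (ProjModel.specOverK k K).hom := by
    show sV ≫ v = Spec.map (CommRingCat.ofHom (algebraMap k K))
    rw [← hg₁, reassoc_of% h₁, M₁.gen_π]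
  let σ : ProjModel.specOverK k K ⟶ Over.mk v := Over.homMk sV hsO
  show (σ ≫ liftToJoinAmbient v g₁ g₂ hg₁ hg₂).left = (joinPointOver M₁ M₂).left
  congr 1
  apply CartesianMonoidalCategory.hom_ext
  · simp only [Category.assoc, liftToJoinAmbient, joinPointOver,
      CartesianMonoidalCategory.lift_fst]
    ext
    exact h₁
  · simp only [Category.assoc, liftToJoinAmbient, joinPointOver,
      CartesianMonoidalCategory.lift_snd]
    ext
    exact h₂

/-- **The join is isomorphic to `M₁` over the domain of definition of `M₁ ⋯→ M₂`.**
[cite: Piltant2013, Lemma 3.3] -/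
theorem isIso_joinFst_morphismRestrict (U : M₁.X.Opens) (f₂ : (U : Scheme.{u}) ⟶ M₂.X)
    (hf₂ : f₂ ≫ M₂.π = U.ι ≫ M₁.π) (sU : Spec (CommRingCat.of K) ⟶ U)
    (h₁ : sU ≫ U.ι = M₁.gen) (h₂ : sU ≫ f₂ = M₂.gen) : IsIso ((joinFst M₁ M₂).f ∣_ U) := by
  let f : (U : Scheme.{u}) ⟶ (joinAmbient M₁ M₂).left :=
    (liftToJoinAmbient (U.ι ≫ M₁.π) U.ι f₂ rfl hf₂).left
  have hf : f ≫ joinAmbientFst M₁ M₂ = U.ι := liftToJoinAmbient_fst _ _ _ _ _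
  have hsU : sU ≫ f = joinPoint M₁ M₂ := comp_left_eq_joinPoint _ _ _ _ _ sU h₁ h₂
  exact ofClosure.isIso_homOf_morphismRestrict M₁ _ _ _ _ M₁ _ _ _ U f hf sU hsU

/-- Symmetrically, **the join is isomorphic to `M₂` over the domain of definition of
`M₂ ⋯→ M₁`**. [cite: Piltant2013, Lemma 3.3] -/
theorem isIso_joinSnd_morphismRestrict (U : M₂.X.Opens) (f₁ : (U : Scheme.{u}) ⟶ M₁.X)
    (hf₁ : f₁ ≫ M₁.π = U.ι ≫ M₂.π) (sU : Spec (CommRingCat.of K) ⟶ U)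
    (h₂ : sU ≫ U.ι = M₂.gen) (h₁ : sU ≫ f₁ = M₁.gen) : IsIso ((joinSnd M₁ M₂).f ∣_ U) := by
  let f : (U : Scheme.{u}) ⟶ (joinAmbient M₁ M₂).left :=
    (liftToJoinAmbient (U.ι ≫ M₂.π) f₁ U.ι hf₁ rfl).left
  have hf : f ≫ joinAmbientSnd M₁ M₂ = U.ι := liftToJoinAmbient_snd _ _ _ _ _
  have hsU : sU ≫ f = joinPoint M₁ M₂ := comp_left_eq_joinPoint _ _ _ _ _ sU h₁ h₂
  exact ofClosure.isIso_homOf_morphismRestrict M₁ _ _ _ _ M₂ _ _ _ U f hf sU hsU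

end Join

end ProperModel

end Literature.AlgebraicGeometry.Resolution

end
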